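import Summits.HodgeConjecture.CorCM.Census.OcticCurveFourfold
import Summits.HodgeConjecture.CorCM.DecicCurveFivefoldFrameTransfer
import HarnessLib

/-!
# COR-CM — `B × E` for an OCTIC CM field `F ⊇ k` (CM fourfold of `k`-signature `(1,3)` × CM curve of `k`): FRAME TRANSFER —
# Galois-balanced weights of every product of copies are model-balanced, and conjugate pairs have algebraic lines

Cell `pub-hodgecm2` (COR-CM), seat b30 gen 18 (2026-08-21); count-neutral own lane OCTIC-EB (lit-andre-3's prover-lane ask
A6-R26 «HC(E^a × B^n) ⇐ Markman's hyperbolic-sixfold theorem», generalised to EVERY octic CM field containing `k`); no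
named fact, no `sorry` (one auxiliary definition: the model map, as in seat b09's `CorCM/DecicCurveFivefoldFrameTransfer.lean`,
whose slot map `DecicCurveFivefold.curveSlots₂` and index-set lemmas are reused BY NAME).  Consumed by
`CorCM/OcticCurveFourfoldWeilSixfold.lean` (Weil parts) and `CorCM/OcticCurveFourfoldPowersHodgeOfMarkman.lean` (assembly).

SETTING.  A family of CM fields `Kf : I → Type`, indices `i₀` (the quadratic field `k = Kf i₀`, `τ : k → ℂ` with
`Hom(k, ℂ) = {τ, τ̄}`) and `i₁` (the octic field `F = Kf i₁`, `i : k → F`); two slots `curveSlots₂ i₀ i₁ = (i₁, i₀)` (the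
fourfold FIRST); realisations `A₂ j ⊨ (Kf (curveSlots₂ j); Φ₂ j)` — `B = A₂ 0 ⊨ (F; Φ)`, `E = A₂ 1 ⊨ (k; {τ})` (`hΨ`).
THE FRAME IS NOT A GROUP.  `e : Hom(F, ℂ) ≃ Fin 4 × Bool` is ANY enumeration with `(e s).2 = [s ∘ i = τ]` (`he_sign`),
`e s̄ = ((e s).1, ¬(e s).2)` (`he_conj`: `.1` numbers the conjugate pairs) and `Φ = e⁻¹{(0,true), (1,false), (2,false),
(3,false)}` (`hΦ`: `k`-signature `(1,3)`, the member of `Φ` over `τ` is `s₊ = e⁻¹(0,true)`); such an `e` exists for every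
`Φ` with `#{s ∈ Φ | s ∘ i = τ} = 1` (`CorCM/OcticCurveFourfoldHodgeOfMarkman.lean`).  No Galois hypothesis on `F`: the only
input is the TRANSITIVITY of `Aut(ℂ)` on `Hom(F, ℂ)` (tree: `Pohlmann1968.isPretransitive_ringEquiv_complex`) and the
commutation of `Aut(ℂ)` with complex conjugation on the embeddings of a CM field (`CMWeights.smul_conj_smul_comm`).

* §1 `comp_eq_tau_iff_of_realises`, `comp_mem_iff_of_realises` — for `ρ ∈ Aut(ℂ)` with `ρ ∘ e⁻¹(p) = s₊`:
  `ρ ∘ σ = τ ⟺ [σ = τ] = p.2` on `Hom(k, ℂ)` and `ρ ∘ s ∈ Φ ⟺ inr (e s) ∈ phiPre p` on `Hom(F, ℂ)` (`ρ` maps conjugate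
  pairs to conjugate pairs and preserves or reverses ALL signs according as `p.2`); hence
  **`modelBalanced_of_isGaloisBalancedAlg`** — an `Aut(ℂ)`-balanced weight of `X = ⨁_j A₂(κ j)` (Pohlmann's condition
  for the CM algebra `∏_j K_{κ j}`) is a balanced configuration of the 10-point model (`Census/OcticCurveFourfold`) under
  `v = toPt e τ ∘ P`, `P (j, s) = (κ j, s)`; `toPt_conj_smul` (`toPt x̄ = cj (toPt x)`), `toPt_injective`.
* §2 `weightClassesAlg_le_algebraicClasses_of_image_eq_pair` — a weight of `Y = ⨁ A₂` whose model image is a conjugate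
  pair `{y, cj y}` is conjugation-stable, so its line is a divisor line (`PairWeights.…_of_conj_smul_mem`).
HONEST FRAMING: nothing about the Hodge conjecture is concluded here; `HC_CM` is not asserted.
[cite: Pohlmann1968, Thm 1] [cite: GaoUllmo2025, Thm 3.1] [cite: Shimura1998, §18.2 Lemma (i)] [cite: Gordon1999HodgeAVSurvey, §9.2]

## References
* [Pohlmann1968] H. Pohlmann, Ann. of Math. 88 (1968), Thm 1.  [GaoUllmo2025] Z. Gao, E. Ullmo, J. Inst. Math. Jussieu 25
  (2025), Thm 3.1 (3.2).  [Shimura1998] G. Shimura, *Abelian varieties with complex multiplication and modular functions*,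
  §18.2 Lemma (i).  [Gordon1999HodgeAVSurvey] B. B. Gordon, CRM Monogr. 10 (1999), §9.2, 9.2.2.
-/

noncomputable section

open CategoryTheory CategoryTheory.Limits NumberField

namespace Summit.HodgeConjecture.CorCM.OcticCurveFourfold

open Literature.AlgebraicGeometry Literature.AlgebraicGeometry.Motives Literature.AlgebraicGeometry.HodgeTheory
open Literature.AlgebraicGeometry.ComplexMultiplication (IsCMTypeRealisation)
open Literature.AlgebraicGeometry.Pohlmann1968
open Literature.AlgebraicTopology.SingularHomology
open Literature.NumberTheory.ComplexMultiplication
open Summit.HodgeConjecture.CorCM.Census.OcticCurveFourfold (Pt sgn cj cj_inl cj_inr phiPre phi inl_mem_phiPre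
  inr_mem_phiPre ModelBalanced)
open Summit.HodgeConjecture.CorCM.DecicCurveFivefold (curveSlots₂ sigma_cases conj_smul_zero conj_smul_one)
open Summit.HodgeConjecture.CorCM.PairWeights
open Summit.HodgeConjecture.CorCM.DihedralSexticPairCurvePowers (ncard_sep_eq_card_filter)

open scoped Classical Pointwise

/-! ## §0 The model map -/

section Defs

variable {I : Type} {Kf : I → Type} [∀ i, Field (Kf i)] {i₀ i₁ : I}

/-- **The model map** `Hom(F × k, ℂ) → Pt`: `(0, s) ↦ inr (e s)`, `(1, σ) ↦ inl [σ = τ]`. [folklore] -/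
def toPt (e : (Kf i₁ →+* ℂ) ≃ Fin 4 × Bool) (τ : Kf i₀ →+* ℂ) :
    ((j : Fin 2) × (Kf (curveSlots₂ i₀ i₁ j) →+* ℂ)) → Pt := fun x =>
  Fin.cases (motive := fun j => (Kf (curveSlots₂ i₀ i₁ j) →+* ℂ) → Pt)
    (fun s => Sum.inr (e s)) (fun _ σ => Sum.inl (decide (σ = τ))) x.1 x.2

/-- `toPt` on the fourfold slot. [folklore] -/
@[simp] theorem toPt_zero (e : (Kf i₁ →+* ℂ) ≃ Fin 4 × Bool) (τ : Kf i₀ →+* ℂ) (s : Kf i₁ →+* ℂ) :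
    toPt e τ ⟨0, s⟩ = Sum.inr (e s) := rfl

/-- `toPt` on the curve slot. [folklore] -/
@[simp] theorem toPt_one (e : (Kf i₁ →+* ℂ) ≃ Fin 4 × Bool) (τ : Kf i₀ →+* ℂ) (σ : Kf i₀ →+* ℂ) :
    toPt e τ ⟨(0 : Fin 1).succ, σ⟩ = Sum.inl (decide (σ = τ)) := rfl

end Defs

/-! ## §1 Frame transfer -/

section Transfer

variable {I : Type} {Kf : I → Type} [∀ i, Field (Kf i)]
  {i₀ i₁ : I} {e : (Kf i₁ →+* ℂ) ≃ Fin 4 × Bool} {τ : Kf i₀ →+* ℂ}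
  (hττ : ComplexEmbedding.conjugate τ ≠ τ) (hk : ∀ σ : Kf i₀ →+* ℂ, σ = τ ∨ σ = ComplexEmbedding.conjugate τ)

include hττ hk in
/-- The model map is injective (`Hom(k, ℂ) = {τ, τ̄}`, `e` a bijection). [folklore] -/
theorem toPt_injective : Function.Injective (toPt (i₀ := i₀) (i₁ := i₁) e τ) := by
  intro x y hxy
  rcases sigma_cases x with ⟨s, rfl⟩ | ⟨σ, rfl⟩ <;> rcases sigma_cases y with ⟨s', rfl⟩ | ⟨σ', rfl⟩
  · rw [toPt_zero, toPt_zero, Sum.inr.injEq] at hxy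
    rw [e.injective hxy]
  · exact absurd hxy (by rw [toPt_zero, toPt_one]; exact Sum.inr_ne_inl)
  · exact absurd hxy (by rw [toPt_zero, toPt_one]; exact Sum.inl_ne_inr)
  · rw [toPt_one, toPt_one, Sum.inl.injEq] at hxy
    rcases hk σ with rfl | rfl <;> rcases hk σ' with rfl | rfl
    · rfl
    · simp only [decide_true] at hxy; exact absurd (of_decide_eq_true hxy.symm) hττ
    · simp only [decide_true] at hxy; exact absurd (of_decide_eq_true hxy) hττ
    · rfl

variable {i : Kf i₀ →+* Kf i₁}
  (he_sign : ∀ s : Kf i₁ →+* ℂ, (e s).2 = true ↔ s.comp i = τ)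
  (he_conj : ∀ s : Kf i₁ →+* ℂ, e (ComplexEmbedding.conjugate s) = ((e s).1, !(e s).2))

/-- An automorphism of `ℂ` acts injectively on complex embeddings. [folklore] -/
theorem comp_injective {K : Type} [Field K] (ρ : ℂ ≃+* ℂ) :
    Function.Injective fun s : K →+* ℂ => (ρ : ℂ →+* ℂ).comp s := fun s s' h =>
  RingHom.ext fun z => ρ.injective (by
    have e1 := RingHom.congr_fun h z
    simpa only [RingHom.coe_comp, RingHom.coe_coe, Function.comp_apply] using e1)

/-- For a CM field, every automorphism of `ℂ` commutes with complex conjugation on its embeddings: `ρ ∘ s̄ = (ρ ∘ s)‾`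
(Mathlib `IsCMField.complexEmbedding_complexConj`). [cite: Shimura1998, §18.2 Lemma (i)] -/
theorem comp_conjugate {K : Type} [Field K] [NumberField K] [IsCMField K] (ρ : ℂ ≃+* ℂ) (s : K →+* ℂ) :
    (ρ : ℂ →+* ℂ).comp (ComplexEmbedding.conjugate s) = ComplexEmbedding.conjugate ((ρ : ℂ →+* ℂ).comp s) := by
  refine RingHom.ext fun a => ?_
  change ρ (starRingEnd ℂ (s a)) = starRingEnd ℂ (ρ (s a))
  rw [← IsCMField.complexEmbedding_complexConj K s a]
  exact IsCMField.complexEmbedding_complexConj K ((ρ : ℂ →+* ℂ).comp s) a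

include he_conj in
/-- Two embeddings of `F` lie in the same conjugate pair (same first coordinate in the frame) iff they are equal or
conjugate. [folklore] -/
theorem fst_eq_fst_iff [NumberField (Kf i₁)] (s t : Kf i₁ →+* ℂ) :
    (e s).1 = (e t).1 ↔ t = s ∨ t = ComplexEmbedding.conjugate s := by
  constructor
  · intro h
    by_cases h2 : (e t).2 = (e s).2
    · left; apply e.injective; exact Prod.ext h.symm h2
    · right; apply e.injective
      rw [he_conj s]
      refine Prod.ext h.symm ?_
      change (e t).2 = !(e s).2
      cases hs : (e s).2 <;> cases ht : (e t).2 <;> simp_all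
  · rintro (rfl | rfl)
    · rfl
    · rw [he_conj s]

include hk he_sign in
/-- In the frame, an embedding `s` of `F` with `(e s).2 = false` restricts to `τ̄`. [folklore] -/
theorem comp_eq_conjugate_of_snd_eq_false {s : Kf i₁ →+* ℂ} (hs : (e s).2 = false) :
    s.comp i = ComplexEmbedding.conjugate τ := by
  rcases hk (s.comp i) with h | h
  · have := (he_sign s).2 h; rw [hs] at this; exact absurd this Bool.false_ne_true
  · exact h

include hττ hk he_sign in
/-- **How a realiser acts on the curve slot.**  If `ρ ∈ Aut(ℂ)` sends `s_p = e⁻¹ p` to `s₊ = e⁻¹(0, true)` then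
`ρ ∘ σ = τ ⟺ [σ = τ] = p.2` (`ρ` fixes `τ` if `s_p` lies over `τ`, i.e. `p.2 = true`, and swaps `τ, τ̄` otherwise).
[cite: Gordon1999HodgeAVSurvey, §9.2] -/
theorem comp_eq_tau_iff_of_realises (ρ : ℂ ≃+* ℂ) {p : Fin 4 × Bool}
    (hρ : (ρ : ℂ →+* ℂ).comp (e.symm p) = e.symm (0, true)) (σ : Kf i₀ →+* ℂ) :
    (ρ : ℂ →+* ℂ).comp σ = τ ↔ decide (σ = τ) = p.2 := by
  -- `s₊` lies over `τ`, and `ρ ∘ (s_p ∘ i) = s₊ ∘ i = τ`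
  have hplus : (e.symm (0, true)).comp i = τ := (he_sign _).1 (by rw [Equiv.apply_symm_apply])
  have hsp : ((ρ : ℂ →+* ℂ).comp (e.symm p)).comp i = τ := by rw [hρ]; exact hplus
  rw [RingHom.comp_assoc] at hsp
  -- `ρ` permutes `{τ, τ̄}` injectively
  have hinj := comp_injective (K := Kf i₀) ρ
  have hρττ : (ρ : ℂ →+* ℂ).comp τ = τ ↔ p.2 = true := by
    constructor
    · intro h
      by_contra hp
      have hp' : (e (e.symm p)).2 = false := by
        rw [Equiv.apply_symm_apply]; cases h2 : p.2 <;> simp_all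
      have hc := comp_eq_conjugate_of_snd_eq_false hk he_sign hp'
      rw [hc] at hsp
      exact hττ (hinj (hsp.trans h.symm))
    · intro hp
      have h1 : (e.symm p).comp i = τ := (he_sign _).1 (by rw [Equiv.apply_symm_apply]; exact hp)
      rwa [h1] at hsp
  rcases hk σ with rfl | rfl
  · rw [hρττ]; cases p.2 <;> simp
  · have hne : decide (ComplexEmbedding.conjugate τ = τ) = false := decide_eq_false hττ
    rw [hne]
    constructor
    · intro h
      by_contra hp
      have hp' : p.2 = true := by cases h2 : p.2 <;> simp_all
      have h2 := hρττ.2 hp'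
      exact hττ (hinj (h.trans h2.symm))
    · intro hp
      have hp' : ¬ p.2 = true := by rw [← hp]; exact Bool.false_ne_true
      -- `ρ ∘ τ ≠ τ`, so `ρ ∘ τ = τ̄` and `ρ ∘ τ̄ = τ`
      have h1 : (ρ : ℂ →+* ℂ).comp τ ≠ τ := fun h => hp' (hρττ.1 h)
      rcases hk ((ρ : ℂ →+* ℂ).comp (ComplexEmbedding.conjugate τ)) with h | h
      · exact h
      · exfalso
        rcases hk ((ρ : ℂ →+* ℂ).comp τ) with h' | h'
        · exact h1 h'
        · exact hττ (hinj (h.trans h'.symm))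

variable {Φ₂ : ∀ j : Fin 2, CMType (Kf (curveSlots₂ i₀ i₁ j))}
  (hΦ : ∀ s : Kf i₁ →+* ℂ, s ∈ (Φ₂ 0).1 ↔ Sum.inr (e s) ∈ phi)
  (hΨ : ∀ σ : Kf i₀ →+* ℂ, σ ∈ (Φ₂ (0 : Fin 1).succ).1 ↔ σ = τ)

include hττ hk he_sign he_conj hΦ in
/-- **How a realiser acts on the fourfold slot.**  If `ρ ∘ e⁻¹(p) = s₊` then `ρ ∘ s ∈ Φ ⟺ inr (e s) ∈ phiPre p`: `ρ` maps
conjugate pairs to conjugate pairs (`comp_conjugate`), so `e(ρ ∘ s)` has first coordinate `0` iff `(e s).1 = p.1`, and it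
preserves all signs if `p.2 = true`, reverses them if `p.2 = false` (`comp_eq_tau_iff_of_realises`).
[cite: GaoUllmo2025, Thm 3.1 (3.2)] [cite: Shimura1998, §18.2 Lemma (i)] -/
theorem comp_mem_iff_of_realises [NumberField (Kf i₁)] [IsCMField (Kf i₁)] (ρ : ℂ ≃+* ℂ) {p : Fin 4 × Bool}
    (hρ : (ρ : ℂ →+* ℂ).comp (e.symm p) = e.symm (0, true)) (s : Kf i₁ →+* ℂ) :
    (ρ : ℂ →+* ℂ).comp s ∈ (Φ₂ 0).1 ↔ Sum.inr (e s) ∈ phiPre p := by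
  have hinj := comp_injective (K := Kf i₁) ρ
  -- first coordinate: `(e (ρ ∘ s)).1 = 0 ↔ (e s).1 = p.1`
  have h1 : (e ((ρ : ℂ →+* ℂ).comp s)).1 = 0 ↔ (e s).1 = p.1 := by
    have e0 : (0 : Fin 4) = (e ((ρ : ℂ →+* ℂ).comp (e.symm p))).1 := by rw [hρ, Equiv.apply_symm_apply]
    have ep : p.1 = (e (e.symm p)).1 := by rw [Equiv.apply_symm_apply]
    rw [e0, ep, fst_eq_fst_iff he_conj, fst_eq_fst_iff he_conj, ← comp_conjugate ρ s]
    exact ⟨fun h => h.elim (fun h => Or.inl (hinj h)) fun h => Or.inr (hinj h),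
      fun h => h.elim (fun h => Or.inl (by rw [h])) fun h => Or.inr (by rw [h])⟩
  -- second coordinate: `(e (ρ ∘ s)).2 = true ↔ (e s).2 = p.2`
  have h2 : (e ((ρ : ℂ →+* ℂ).comp s)).2 = true ↔ (e s).2 = p.2 := by
    rw [he_sign, RingHom.comp_assoc, comp_eq_tau_iff_of_realises hττ hk he_sign ρ hρ (s.comp i)]
    have : decide (s.comp i = τ) = (e s).2 := by
      cases hs : (e s).2
      · exact decide_eq_false fun h => by rw [(he_sign s).2 h] at hs; exact Bool.noConfusion hs
      · exact decide_eq_true ((he_sign s).1 hs)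
    rw [this]
  rw [hΦ, phi, inr_mem_phiPre, inr_mem_phiPre]
  have h2' : (e ((ρ : ℂ →+* ℂ).comp s)).2 = true ↔ (e s).2 = p.2 := h2
  constructor
  · rintro (h | ⟨hb, ha⟩)
    · left
      exact Prod.ext (h1.1 (by rw [h])) (h2'.1 (by rw [h]))
    · right
      exact ⟨fun hb' => hb (h2'.2 hb'), fun ha' => ha (h1.2 ha')⟩
  · rintro (h | ⟨hb, ha⟩)
    · left
      exact Prod.ext (h1.2 (by rw [h])) (h2'.2 (by rw [h]))
    · right
      refine ⟨fun hb' => hb (h2'.1 hb'), fun ha' => ha (h1.1 ha')⟩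

include hττ hk he_sign he_conj hΦ hΨ in
/-- **Membership read in the frame**: for a realiser `ρ` of `p` (`ρ ∘ e⁻¹ p = s₊`), `ρ ∘ x ∈ Φ₂ ↔ toPt x ∈ phiPre p`.
[cite: GaoUllmo2025, Thm 3.1 (3.2)] -/
theorem comp_mem_iff_toPt_mem [NumberField (Kf i₁)] [IsCMField (Kf i₁)] {ρ : ℂ ≃+* ℂ} {p : Fin 4 × Bool}
    (hρ : (ρ : ℂ →+* ℂ).comp (e.symm p) = e.symm (0, true)) (x : (j : Fin 2) × (Kf (curveSlots₂ i₀ i₁ j) →+* ℂ)) :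
    (ρ : ℂ →+* ℂ).comp x.2 ∈ (Φ₂ x.1).1 ↔ toPt e τ x ∈ phiPre p := by
  rcases sigma_cases x with ⟨s, rfl⟩ | ⟨σ, rfl⟩
  · exact comp_mem_iff_of_realises hττ hk he_sign he_conj hΦ ρ hρ s
  · change (ρ : ℂ →+* ℂ).comp σ ∈ (Φ₂ (0 : Fin 1).succ).1 ↔ _
    rw [hΨ, toPt_one, inl_mem_phiPre, comp_eq_tau_iff_of_realises hττ hk he_sign ρ hρ σ]

/-- **`Aut(ℂ)` is transitive on `Hom(F, ℂ)`** for a number field `F` (the tree's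
`Pohlmann1968.isPretransitive_ringEquiv_complex`): every label `p` has a realiser `ρ` with `ρ ∘ e⁻¹ p = s₊`. [folklore] -/
theorem exists_realiser [NumberField (Kf i₁)] (e : (Kf i₁ →+* ℂ) ≃ Fin 4 × Bool) (p : Fin 4 × Bool) :
    ∃ ρ : ℂ ≃+* ℂ, (ρ : ℂ →+* ℂ).comp (e.symm p) = e.symm (0, true) := by
  haveI := isPretransitive_ringEquiv_complex (K := Kf i₁)
  obtain ⟨ρ, hρ⟩ := MulAction.exists_smul_eq (ℂ ≃+* ℂ) (e.symm p) (e.symm (0, true))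
  exact ⟨ρ, hρ⟩

variable {N : ℕ} (κ : Fin N → Fin 2)

include hττ hk he_sign he_conj hΦ hΨ in
/-- **FRAME TRANSFER FOR THE POWERS**: an `Aut(ℂ)`-balanced weight of `X = ⨁_j A₂(κ j)` (`IsGaloisBalancedAlg` for the CM
algebra `∏_j K_{κ j}`, types `Φ₂ (κ j)`) is a balanced configuration of the 10-point model under `v = toPt e τ ∘ P`,
`P (j, s) = (κ j, s)`: each of the eight labels is realised by an automorphism of `ℂ` (transitivity), whose balance
condition is the model's equation for that label. [cite: GaoUllmo2025, Thm 3.1 (3.2)] [cite: Pohlmann1968, Thm 1] -/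
theorem modelBalanced_of_isGaloisBalancedAlg [NumberField (Kf i₁)] [IsCMField (Kf i₁)]
    {S : Finset ((j : Fin N) × (Kf (curveSlots₂ i₀ i₁ (κ j)) →+* ℂ))}
    (hS : IsGaloisBalancedAlg (K := fun j => Kf (curveSlots₂ i₀ i₁ (κ j))) (fun j => Φ₂ (κ j)) S) :
    ModelBalanced (fun x => toPt e τ ((Sigma.map κ (fun _ => id) :
      ((j : Fin N) × (Kf (curveSlots₂ i₀ i₁ (κ j)) →+* ℂ)) → ((m : Fin 2) × (Kf (curveSlots₂ i₀ i₁ m) →+* ℂ))) x)) S := by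
  intro p
  beta_reduce
  obtain ⟨ρ, hρ⟩ := exists_realiser e p
  have h := hS ρ
  rw [ncard_sep_eq_card_filter, ncard_sep_eq_card_filter] at h
  have key : ∀ x : (j : Fin N) × (Kf (curveSlots₂ i₀ i₁ (κ j)) →+* ℂ),
      (ρ : ℂ →+* ℂ).comp x.2 ∈ (Φ₂ (κ x.1)).1 ↔ toPt e τ ((Sigma.map κ (fun _ => id) :
        ((j : Fin N) × (Kf (curveSlots₂ i₀ i₁ (κ j)) →+* ℂ)) → ((m : Fin 2) × (Kf (curveSlots₂ i₀ i₁ m) →+* ℂ))) x)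
          ∈ phiPre p :=
    fun x => comp_mem_iff_toPt_mem hττ hk he_sign he_conj hΦ hΨ hρ ⟨κ x.1, x.2⟩
  rw [Finset.filter_congr fun x _ => key x, Finset.filter_congr fun x _ => (key x).not] at h
  have htot := Finset.card_filter_add_card_filter_not
    (s := S) (fun x => toPt e τ ((Sigma.map κ (fun _ => id) :
        ((j : Fin N) × (Kf (curveSlots₂ i₀ i₁ (κ j)) →+* ℂ)) → ((m : Fin 2) × (Kf (curveSlots₂ i₀ i₁ m) →+* ℂ))) x)
          ∈ phiPre p)
  omega

include he_conj hττ hk in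
/-- Conjugation is read in the model: `toPt x̄ = cj (toPt x)`. [folklore] -/
theorem toPt_conj_smul (x : (j : Fin 2) × (Kf (curveSlots₂ i₀ i₁ j) →+* ℂ)) :
    toPt e τ ((starRingAut : ℂ ≃+* ℂ) • x) = cj (toPt e τ x) := by
  rcases sigma_cases x with ⟨s, rfl⟩ | ⟨σ, rfl⟩
  · rw [conj_smul_zero, toPt_zero, toPt_zero, he_conj]
    rfl
  · have key : decide (ComplexEmbedding.conjugate σ = τ) = !decide (σ = τ) := by
      rcases hk σ with rfl | rfl
      · rw [decide_eq_false hττ]; simp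
      · rw [ComplexEmbedding.involutive_conjugate, decide_eq_false hττ]; simp
    rw [conj_smul_one, toPt_one, toPt_one, key, cj_inl]

end Transfer

/-! ## §2 Conjugate pairs of `Y = B × E` have algebraic (divisor) lines -/

section Generators

variable {I : Type} {Kf : I → Type} [∀ i, Field (Kf i)] [∀ i, NumberField (Kf i)] [∀ i, IsCMField (Kf i)]
  {i₀ i₁ : I} {e : (Kf i₁ →+* ℂ) ≃ Fin 4 × Bool} {τ : Kf i₀ →+* ℂ}
  (hττ : ComplexEmbedding.conjugate τ ≠ τ) (hk : ∀ σ : Kf i₀ →+* ℂ, σ = τ ∨ σ = ComplexEmbedding.conjugate τ)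
  (he_conj : ∀ s : Kf i₁ →+* ℂ, e (ComplexEmbedding.conjugate s) = ((e s).1, !(e s).2))
  {A₂ : Fin 2 → AbelianVariety ℂ} {Φ₂ : ∀ j : Fin 2, CMType (Kf (curveSlots₂ i₀ i₁ j))}
  {ι₂ : ∀ j, 𝓞 (Kf (curveSlots₂ i₀ i₁ j)) →+* End (A₂ j)}
  {θ₂ : ∀ j, Kf (curveSlots₂ i₀ i₁ j) →+* Module.End ℂ (complexBetti (A₂ j).X 1)}
  (hA : ∀ j, IsCMTypeRealisation (Φ₂ j) (A₂ j) (ι₂ j) (θ₂ j))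

include hττ hk he_conj hA in
/-- **A weight whose model image is a conjugate pair `{y, cj y}` is conjugation-stable, so its line is algebraic** (a
divisor line: Lefschetz `(1,1)` on the abelian variety `⨁ A₂`). [cite: Gordon1999HodgeAVSurvey, 9.2.2] -/
theorem weightClassesAlg_le_algebraicClasses_of_image_eq_pair
    {T : Finset ((j : Fin 2) × (Kf (curveSlots₂ i₀ i₁ j) →+* ℂ))} {y : Pt} (hT : T.image (toPt e τ) = {y, cj y}) :
    T.card = 2 ∧ weightClassesAlg A₂ ι₂ (2 * 1) T ≤ algebraicClasses (⨁ A₂).X 1 := by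
  have hinj := toPt_injective (e := e) hττ hk (i₁ := i₁)
  have hcard : T.card = 2 := by
    rw [← Finset.card_image_of_injective T hinj, hT]
    exact Finset.card_pair (Census.OcticCurveFourfold.cj_facts.2.1 y).symm
  refine ⟨hcard, weightClassesAlg_le_algebraicClasses_of_conj_smul_mem hA (m := 1) hcard fun x hx => ?_⟩
  have hx' : toPt e τ x ∈ ({y, cj y} : Finset Pt) := hT ▸ Finset.mem_image_of_mem _ hx
  have hcx : toPt e τ ((starRingAut : ℂ ≃+* ℂ) • x) ∈ T.image (toPt e τ) := by
    rw [toPt_conj_smul hττ hk he_conj x, hT, Finset.mem_insert, Finset.mem_singleton] at *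
    rcases hx' with h | h
    · exact Or.inr (by rw [h])
    · exact Or.inl (by rw [h, Census.OcticCurveFourfold.cj_facts.1])
  exact (hinj.mem_finset_image).1 hcx

end Generators

end Summit.HodgeConjecture.CorCM.OcticCurveFourfold

end
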